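/-
Copyright (c) 2026 the pub-hodgecm-mathlib formalisation cell (harness21).  Prover seat hodgecm-mathlib-F0P2-p01 (g26); E1 keeper ∕ dealer
F0P3a-p03 (g29) (E1 ledger row 47b R-b «MACKEY FOR `Hom_K(E, (Ind_H^G σ)|_K)`», census row 47 `CENSUS-NONELL-VANISHING.v1` (F0P3-p02 (g26)) §2 (A2) ∕ §5 R47-b;
LEAD F0P3a-plan (g16) rule-20 generic brick); 2026-09-03.
-/
import Literature.NumberTheory.Automorphic.SmoothInductionDoubleCosetFixed   -- ★ row 15 MACKEY-FIXED (the `E = 𝟙` case): `mem_subgroupOf_map_conj_iff`, the double-coset dictionary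
import Mathlib.RepresentationTheory.Intertwining
import HarnessLib

/-!
# Mackey's formula for `Hom_K(E, (Ind_H^G σ)|_K)` along a double-coset decomposition `G = ⨆ᵢ H gᵢ K`
# (Bernstein–Zelevinsky 1977 §2.3; Cartier 1979 §III.3; Bump 1997 Exercise 4.5.5)

Topic `NumberTheory/Automorphic`; namespace `Representation` (sibling of ★ `SmoothInductionDoubleCosetFixed`, whose `K`-FIXED-VECTOR formula `(Ind_H^G σ)^K ≃ Πᵢ W^{σ(H ∩ gᵢKgᵢ⁻¹)}`
is the case `E = 𝟙` of this file).  THEOREMS ONLY (no definition, no instance, no notation, no named fact, no `sorry`).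

SETTING: a topological group `G`, subgroups `H, K ≤ G` with `K` OPEN, a representation `σ` of `H` on `W`, a SMOOTH representation `τ` of `K` on `E` (`hτ`; e.g. `E` finite-dimensional with
an open kernel), the smooth induction ★ `smoothIndRep H σ` restricted to `K` (`(smoothIndRep H σ).comp K.subtype`), and double-coset representatives `g : ι → G` (`hcover`, `hdisj` as in ★ row 15).
For a representative `x` the LOCAL GROUP is the subgroup `S_x = {s ∈ K : x s x⁻¹ ∈ H}` of `K`, spelled `(H.map (MulAut.conj x⁻¹).toMonoidHom).subgroupOf K` (membership
`mem_subgroupOf_map_conj_inv_iff`), and the LOCAL TARGET is the transported representation `σˣ(s) = σ(x s x⁻¹)` of `S_x` on `W` — taken HYPOTHESIS-STYLE as any `σc : Representation k ↥S_x W` with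
`hσc : ∀ s, σc s = σ ⟨x s x⁻¹, _⟩` (for a character `χ` of `H` this is `s ↦ χ(x s x⁻¹)`; no transport constructor is introduced).
* §0 `mem_subgroupOf_map_conj_inv_iff`.
* §1 (M1) `toFun_apply_rep_of_mem` — for a `K`-map `Φ : E → Ind_H^G σ` and `s ∈ S_x`: `(Φ(τ s e))(x) = σ(x s x⁻¹) (Φ e)(x)`, i.e. `e ↦ (Φ e)(x)` is a local intertwiner; `toFun_apply_eq_of_eq_mul` —
  `(Φ e)(h x κ) = σ h (Φ(τ κ e))(x)`.
* §2 (M2) `intertwiningMap_ext_of_forall_toFun_apply_eq` — `Φ` is determined by the local maps `e ↦ (Φ e)(gᵢ)` (needs `hcover`); `apply_apply_eq_of_mul_mul_eq` — well-definedness of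
  `h gᵢ κ ↦ σ h φᵢ(τ κ e)` for a local intertwiner `φᵢ`.
* §3 (M3) `exists_intertwiningMap_forall_toFun_eq` — every family of local intertwiners `φᵢ : Hom_{S_{gᵢ}}(E|, σ^{gᵢ})` comes from a unique `K`-map `Φ` with `(Φ e)(gᵢ) = φᵢ e` (needs `hdisj`, `K`
  open and `τ` smooth: the vector `Φ e` is fixed by the open stabiliser of `e` in `K`).
* §4 (M4) **`nonempty_intertwiningMap_linearEquiv_pi`** — `Hom_K(E, (Ind_H^G σ)|_K) ≃ₗ[k] Πᵢ Hom_{S_{gᵢ}}(E|_{S_{gᵢ}}, σ^{gᵢ})` through `Φ ↦ (e ↦ (Φ e)(gᵢ))ᵢ`; over a field with everything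
  finite: **`finrank_intertwiningMap_smoothIndRep_eq_sum`** — `dim Hom_K(E, Ind|_K) = Σᵢ dim Hom_{S_{gᵢ}}(E, σ^{gᵢ})` (and `≤` from `hcover` alone); the ONE-COSET case `G = H·K`:
  **`finrank_intertwiningMap_smoothIndRep_eq_of_mul`** — `dim Hom_K(E, Ind|_K) = dim Hom_{H ∩ K}(E, σ)` with `S_1 = H ∩ K` read inside `K`.
Consumer (cell `pub/hodgecm-mathlib`, crux H413, E1 row 47 ROUTE A (A2)): `d(F) = dim Hom_{P_F}(V^{U_F}, i_Bχ|_{P_F}) = Σ_{B∖G∕P_F} dim Hom_{P_F ∩ g⁻¹Bg}(V^{U_F}, (χδ^{1∕2})^g)` at the two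
vertex types (Iwasawa: one coset) and at the edge (Bruhat–Iwahori: two cosets).  HONEST LABEL: count-neutral generic base layer; E1 = PRINT until the charter test; HC_CM is proved only
modulo the printed citations until rung 0 closes.

## References
* [BernsteinZelevinsky1977] I. N. Bernstein, A. V. Zelevinsky, *Induced representations of reductive 𝔭-adic groups I*, Ann. Sci. ÉNS 10 (1977), §2.3 (geometric lemma ∕ Mackey theory).
* [CartierCorvallis1979] P. Cartier, *Representations of 𝔭-adic groups: a survey*, PSPM 33.1 (1979), §III.3.
* [Bump1997] D. Bump, *Automorphic Forms and Representations* (1997), Exercise 4.5.5 p. 488 («simple Mackey theory»: `Hom_G(V₁, V₂) ≅ ⊕_γ Hom_{S_γ}(σ_{1,γ}, σ_{2,γ})`).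
-/

set_option autoImplicit false

noncomputable section

open Topology

namespace Representation

variable {k G W E : Type*} [CommRing k] [Group G] [TopologicalSpace G] [IsTopologicalGroup G] [AddCommGroup W] [Module k W] [AddCommGroup E] [Module k E]
  (H K : Subgroup G) (σ : Representation k H W) (τ : Representation k K E)

/-! ## §0 The local groups `S_x = {s ∈ K : x s x⁻¹ ∈ H}` -/

omit [TopologicalSpace G] [IsTopologicalGroup G] in
/-- Membership in `S_x ≤ K`, spelled `(H.map (MulAut.conj x⁻¹).toMonoidHom).subgroupOf K`: `s` belongs to it iff `x s x⁻¹ ∈ H`. [cite: BernsteinZelevinsky1977, §2.3] -/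
theorem mem_subgroupOf_map_conj_inv_iff (x : G) (s : K) :
    s ∈ (H.map (MulAut.conj x⁻¹).toMonoidHom).subgroupOf K ↔ x * (s : G) * x⁻¹ ∈ H := by
  rw [mem_subgroupOf_map_conj_iff, inv_inv]

/-! ## §1 The local intertwiners `e ↦ (Φ e)(x)` of a `K`-map `Φ : E → Ind_H^G σ` -/

variable {H K σ τ} in
/-- **(M1) `(Φ(τ s e))(x) = σ(x s x⁻¹) · (Φ e)(x)` for `s ∈ S_x`**: `K`-equivariance gives `(Φ(τ s e))(x) = (Φ e)(x s) = (Φ e)((x s x⁻¹) x)` and `H`-equivariance of the section finishes.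
[cite: BernsteinZelevinsky1977, §2.3] [cite: CartierCorvallis1979, §III.3] -/
theorem toFun_apply_rep_of_mem (Φ : τ.IntertwiningMap ((smoothIndRep H σ).comp K.subtype)) (x : G) (s : K) (hs : x * (s : G) * x⁻¹ ∈ H) (e : E) :
    (Φ (τ s e)).toFun x = σ ⟨x * (s : G) * x⁻¹, hs⟩ ((Φ e).toFun x) := by
  rw [Φ.isIntertwining, MonoidHom.comp_apply, Subgroup.coe_subtype, toFun_smoothIndRep_apply]
  have hx : ((⟨x * (s : G) * x⁻¹, hs⟩ : H) : G) * x = x * (s : G) := by rw [Subgroup.coe_mk, inv_mul_cancel_right]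
  have h2 := (Φ e).toFun_subgroup_mul ⟨x * (s : G) * x⁻¹, hs⟩ x
  rw [hx] at h2
  exact h2

variable {H K σ τ} in
/-- **The value of `Φ e` on the double coset `H x K`**: `(Φ e)(h x κ) = σ h (Φ(τ κ e))(x)` for `h ∈ H`, `κ ∈ K`. [cite: BernsteinZelevinsky1977, §2.3] [cite: CartierCorvallis1979, §III.3] -/
theorem toFun_apply_eq_of_eq_mul (Φ : τ.IntertwiningMap ((smoothIndRep H σ).comp K.subtype)) {y x : G} {h : H} {κ : K} (hy : y = h * x * κ) (e : E) :
    (Φ e).toFun y = σ h ((Φ (τ κ e)).toFun x) := by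
  rw [hy, mul_assoc, (Φ e).toFun_subgroup_mul, Φ.isIntertwining, MonoidHom.comp_apply, Subgroup.coe_subtype, toFun_smoothIndRep_apply]

/-! ## §2 Injectivity and well-definedness -/

variable {H K σ τ} in
/-- **(M2) `Φ` is determined by its local intertwiners** `e ↦ (Φ e)(gᵢ)` when the double cosets `H gᵢ K` cover `G`. [cite: BernsteinZelevinsky1977, §2.3] [cite: CartierCorvallis1979, §III.3] -/
theorem intertwiningMap_ext_of_forall_toFun_apply_eq {ι : Type*} {g : ι → G} (hcover : ∀ y : G, ∃ i, ∃ h : H, ∃ κ ∈ K, y = h * g i * κ)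
    {Φ Φ' : τ.IntertwiningMap ((smoothIndRep H σ).comp K.subtype)} (he : ∀ (i : ι) (e : E), (Φ e).toFun (g i) = (Φ' e).toFun (g i)) : Φ = Φ' := by
  refine IntertwiningMap.ext (LinearMap.ext fun e => SmoothInd.ext (funext fun y => ?_))
  obtain ⟨i, h, κ, hκ, hy⟩ := hcover y
  change (Φ e).toFun y = (Φ' e).toFun y
  rw [toFun_apply_eq_of_eq_mul Φ (κ := ⟨κ, hκ⟩) hy e, toFun_apply_eq_of_eq_mul Φ' (κ := ⟨κ, hκ⟩) hy e, he i]

variable {H K σ τ} in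
omit [TopologicalSpace G] [IsTopologicalGroup G] in
/-- **Well-definedness of `h x κ ↦ σ h φ(τ κ e)`** for a local intertwiner `φ` at `x` (`φ (τ s e) = σ(x s x⁻¹) φ e` on `S_x`): if `h x κ = h′ x κ′` then `s := κ′ κ⁻¹ ∈ S_x` with `x s x⁻¹ = h′⁻¹ h`.
[cite: BernsteinZelevinsky1977, §2.3] [cite: CartierCorvallis1979, §III.3] -/
theorem apply_apply_eq_of_mul_mul_eq {x : G} (φ : E →ₗ[k] W)
    (hφ : ∀ (s : K) (hs : x * (s : G) * x⁻¹ ∈ H) (e : E), φ (τ s e) = σ ⟨x * (s : G) * x⁻¹, hs⟩ (φ e))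
    {h h' : H} {κ κ' : K} (he : (h : G) * x * κ = h' * x * κ') (e : E) : σ h (φ (τ κ e)) = σ h' (φ (τ κ' e)) := by
  -- `s := κ' κ⁻¹ ∈ S_x` with `x s x⁻¹ = h'⁻¹ h`
  have hs : x * ((κ' * κ⁻¹ : K) : G) * x⁻¹ = ((h'⁻¹ * h : H) : G) := by
    rw [Subgroup.coe_mul, Subgroup.coe_inv, Subgroup.coe_mul, Subgroup.coe_inv]
    calc x * ((κ' : G) * (κ : G)⁻¹) * x⁻¹ = (h' : G)⁻¹ * ((h' : G) * x * κ') * (κ : G)⁻¹ * x⁻¹ := by group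
      _ = (h' : G)⁻¹ * ((h : G) * x * κ) * (κ : G)⁻¹ * x⁻¹ := by rw [he]
      _ = (h' : G)⁻¹ * h := by group
  have hsH : x * ((κ' * κ⁻¹ : K) : G) * x⁻¹ ∈ H := by rw [hs]; exact (h'⁻¹ * h).2
  have hmk : (⟨x * ((κ' * κ⁻¹ : K) : G) * x⁻¹, hsH⟩ : H) = h'⁻¹ * h := Subtype.ext hs
  have key : φ (τ κ' e) = σ (h'⁻¹ * h) (φ (τ κ e)) := by
    have h1 : τ κ' e = τ (κ' * κ⁻¹) (τ κ e) := by rw [← Module.End.mul_apply, ← map_mul, inv_mul_cancel_right]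
    rw [h1, hφ _ hsH, hmk]
  rw [key, ← Module.End.mul_apply, ← map_mul, mul_inv_cancel_left]

/-! ## §3 Surjectivity: a family of local intertwiners comes from a `K`-map -/

variable {H K σ τ} in
/-- **(M3) SURJECTIVITY.**  `K` open, `τ` smooth, `gᵢ` covering and pairwise inequivalent double-coset representatives; for each `i` a local target `σcᵢ = σ^{gᵢ}` on `S_{gᵢ}` (`hσc`) and a local
intertwiner `φᵢ ∈ Hom_{S_{gᵢ}}(E|, σcᵢ)`.  Then there is a `K`-map `Φ : E → Ind_H^G σ` with `(Φ e)(gᵢ) = φᵢ e` and `(Φ e)(h gᵢ κ) = σ h φᵢ(τ κ e)` — the section `Φ e : y = h gᵢ κ ↦ σ h φᵢ(τ κ e)`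
is well defined (§2), `H`-equivariant, and SMOOTH: it is fixed by the open stabiliser of `e` in `K`. [cite: BernsteinZelevinsky1977, §2.3] [cite: CartierCorvallis1979, §III.3] [cite: Bump1997, Exercise 4.5.5] -/
theorem exists_intertwiningMap_forall_toFun_eq {ι : Type*} {g : ι → G} (hKo : IsOpen (K : Set G)) (hτ : τ.IsSmooth)
    (hcover : ∀ y : G, ∃ i, ∃ h : H, ∃ κ ∈ K, y = h * g i * κ)
    (hdisj : ∀ i j, (∃ h : H, ∃ κ ∈ K, g j = h * g i * κ) → i = j)
    (σc : ∀ i, Representation k ↥((H.map (MulAut.conj (g i)⁻¹).toMonoidHom).subgroupOf K) W)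
    (hσc : ∀ (i : ι) (s : ↥((H.map (MulAut.conj (g i)⁻¹).toMonoidHom).subgroupOf K)),
      σc i s = σ ⟨g i * ((s : K) : G) * (g i)⁻¹, (mem_subgroupOf_map_conj_inv_iff H K (g i) s).1 s.2⟩)
    (φ : ∀ i, IntertwiningMap (τ.comp ((H.map (MulAut.conj (g i)⁻¹).toMonoidHom).subgroupOf K).subtype) (σc i)) :
    ∃ Φ : τ.IntertwiningMap ((smoothIndRep H σ).comp K.subtype),
      (∀ (i : ι) (e : E), (Φ e).toFun (g i) = φ i e) ∧
      ∀ (i : ι) (h : H) (κ : K) (e : E), (Φ e).toFun (h * g i * κ) = σ h (φ i (τ κ e)) := by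
  classical
  choose ii hh κκ hκκ hdec using hcover
  -- the local intertwiners as plain linear maps with the `S`-equivariance
  have hφ : ∀ (i : ι) (s : K) (hs : g i * (s : G) * (g i)⁻¹ ∈ H) (e : E), φ i (τ s e) = σ ⟨g i * (s : G) * (g i)⁻¹, hs⟩ (φ i e) := by
    intro i s hs e
    have hmem : s ∈ (H.map (MulAut.conj (g i)⁻¹).toMonoidHom).subgroupOf K := (mem_subgroupOf_map_conj_inv_iff H K (g i) s).2 hs
    have h1 : φ i (τ s e) = σc i ⟨s, hmem⟩ (φ i e) := LinearMap.congr_fun ((φ i).isIntertwining' ⟨s, hmem⟩) e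
    rw [hσc i ⟨s, hmem⟩] at h1
    exact h1
  -- the section attached to `e`
  let F : E → G → W := fun e y => σ (hh y) (φ (ii y) (τ ⟨κκ y, hκκ y⟩ e))
  have hF : ∀ (e : E) (y : G) (i : ι) (h : H) (κ : K), y = h * g i * κ → F e y = σ h (φ i (τ κ e)) := by
    intro e y i h κ hy
    have hij : ii y = i := by
      refine hdisj (ii y) i ⟨h⁻¹ * hh y, κκ y * (κ : G)⁻¹, K.mul_mem (hκκ y) (K.inv_mem κ.2), ?_⟩
      rw [Subgroup.coe_mul, Subgroup.coe_inv]
      calc g i = (h : G)⁻¹ * ((h : G) * g i * κ) * (κ : G)⁻¹ := by group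
        _ = (h : G)⁻¹ * ((hh y : G) * g (ii y) * κκ y) * (κ : G)⁻¹ := by rw [← hy, ← hdec y]
        _ = (h : G)⁻¹ * hh y * g (ii y) * (κκ y * (κ : G)⁻¹) := by group
    subst hij
    have hdec' : (hh y : G) * g (ii y) * ((⟨κκ y, hκκ y⟩ : K) : G) = h * g (ii y) * κ := (hdec y).symm.trans hy
    exact apply_apply_eq_of_mul_mul_eq (φ (ii y) : E →ₗ[k] W) (hφ (ii y)) hdec' e
  -- `H`-equivariance of each section
  have hFmem : ∀ e, F e ∈ coindV H.subtype σ := by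
    intro e
    rw [mem_indFun_iff]
    intro h y
    rw [hF e (h * y) (ii y) (h * hh y) ⟨κκ y, hκκ y⟩ (by rw [Subgroup.coe_mul, mul_assoc, mul_assoc, ← mul_assoc (hh y : G), ← hdec y]),
      hF e y (ii y) (hh y) ⟨κκ y, hκκ y⟩ (hdec y), map_mul, Module.End.mul_apply]
  -- translation by `κ ∈ K`: `F e (y κ) = F (τ κ e) y`
  have hFK : ∀ (κ : K) (e : E) (y : G), F e (y * κ) = F (τ κ e) y := fun κ e y => by
    rw [hF e (y * κ) (ii y) (hh y) (⟨κκ y, hκκ y⟩ * κ) (by rw [Subgroup.coe_mul, ← mul_assoc, ← hdec y]),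
      hF (τ κ e) y (ii y) (hh y) ⟨κκ y, hκκ y⟩ (hdec y), map_mul, Module.End.mul_apply]
  -- smoothness: the stabiliser of `F e` contains the (open) stabiliser of `e` in `K`
  have hFsm : ∀ e, (indFun H σ).IsSmoothVector (⟨F e, hFmem e⟩ : coindV H.subtype σ) := by
    intro e
    have hopen : IsOpen (((τ.stabilizerSubgroup e).map K.subtype : Subgroup G) : Set G) := by
      rw [Subgroup.coe_map]
      exact hKo.isOpenMap_subtype_val _ (hτ e)
    refine (indFun H σ).isSmoothVector_of_le hopen fun z hz => ?_
    obtain ⟨κ, hκ, rfl⟩ := Subgroup.mem_map.1 hz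
    rw [mem_stabilizerSubgroup]
    refine Subtype.ext (funext fun y => ?_)
    change F e (y * (κ : G)) = F e y
    rw [hFK κ e y, (τ.mem_stabilizerSubgroup e κ).1 hκ]
  let f : E → SmoothInd H σ := fun e => (⟨⟨F e, hFmem e⟩, hFsm e⟩ : ↥(smoothInd H σ).toSubmodule)
  have hf : ∀ e, (f e).toFun = F e := fun e => rfl
  -- linearity in `e`
  have hadd : ∀ e e', f (e + e') = f e + f e' := fun e e' => SmoothInd.ext (funext fun y => by
    change σ (hh y) (φ (ii y) (τ ⟨κκ y, hκκ y⟩ (e + e'))) = σ (hh y) (φ (ii y) (τ ⟨κκ y, hκκ y⟩ e)) + σ (hh y) (φ (ii y) (τ ⟨κκ y, hκκ y⟩ e'))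
    rw [map_add, map_add, map_add])
  have hsmul : ∀ (c : k) e, f (c • e) = c • f e := fun c e => SmoothInd.ext (funext fun y => by
    change σ (hh y) (φ (ii y) (τ ⟨κκ y, hκκ y⟩ (c • e))) = c • σ (hh y) (φ (ii y) (τ ⟨κκ y, hκκ y⟩ e))
    rw [map_smul, map_smul, map_smul])
  refine ⟨⟨{ toFun := f, map_add' := hadd, map_smul' := hsmul }, fun κ => LinearMap.ext fun e => SmoothInd.ext (funext fun y => ?_)⟩,
    fun i e => ?_, fun i h κ e => ?_⟩
  · -- `K`-equivariance: `f (τ κ e) = κ · f e`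
    change F (τ κ e) y = F e (y * (κ : G))
    rw [hFK]
  · change F e (g i) = φ i e
    rw [hF e (g i) i 1 1 (by rw [Subgroup.coe_one, Subgroup.coe_one, one_mul, mul_one]), map_one, map_one, Module.End.one_apply, Module.End.one_apply]
  · change F e (h * g i * κ) = σ h (φ i (τ κ e))
    exact hF e _ i h κ rfl

/-! ## §4 `Hom_K(E, (Ind_H^G σ)|_K) ≃ Πᵢ Hom_{S_{gᵢ}}(E, σ^{gᵢ})` and dimension counts -/

variable {H K σ τ} in
/-- **The evaluation map `Φ ↦ (e ↦ (Φ e)(gᵢ))ᵢ : Hom_K(E, (Ind_H^G σ)|_K) →ₗ[k] Πᵢ Hom_{S_{gᵢ}}(E|_{S_{gᵢ}}, σ^{gᵢ})` exists, is `k`-linear and INJECTIVE** as soon as the double cosets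
`H gᵢ K` cover `G` (local targets `σcᵢ = σ^{gᵢ}` hypothesis-style). [cite: BernsteinZelevinsky1977, §2.3] [cite: CartierCorvallis1979, §III.3] -/
theorem exists_linearMap_pi_intertwiningMap_injective {ι : Type*} {g : ι → G}
    (hcover : ∀ y : G, ∃ i, ∃ h : H, ∃ κ ∈ K, y = h * g i * κ)
    (σc : ∀ i, Representation k ↥((H.map (MulAut.conj (g i)⁻¹).toMonoidHom).subgroupOf K) W)
    (hσc : ∀ (i : ι) (s : ↥((H.map (MulAut.conj (g i)⁻¹).toMonoidHom).subgroupOf K)),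
      σc i s = σ ⟨g i * ((s : K) : G) * (g i)⁻¹, (mem_subgroupOf_map_conj_inv_iff H K (g i) s).1 s.2⟩) :
    ∃ ev : τ.IntertwiningMap ((smoothIndRep H σ).comp K.subtype) →ₗ[k] (Π i, IntertwiningMap (τ.comp ((H.map (MulAut.conj (g i)⁻¹).toMonoidHom).subgroupOf K).subtype) (σc i)),
      Function.Injective ev ∧ ∀ (Φ : τ.IntertwiningMap ((smoothIndRep H σ).comp K.subtype)) (i : ι) (v : E), ev Φ i v = (Φ v).toFun (g i) := by
  classical
  -- the local intertwiner of `Φ` at `gᵢ`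
  have hloc : ∀ (Φ : τ.IntertwiningMap ((smoothIndRep H σ).comp K.subtype)) (i : ι) (s : ↥((H.map (MulAut.conj (g i)⁻¹).toMonoidHom).subgroupOf K)) (v : E),
      (Φ (τ (s : K) v)).toFun (g i) = σc i s ((Φ v).toFun (g i)) := by
    intro Φ i s v
    rw [hσc i s]
    exact toFun_apply_rep_of_mem Φ (g i) (s : K) _ v
  let ev : τ.IntertwiningMap ((smoothIndRep H σ).comp K.subtype) →ₗ[k] (Π i, IntertwiningMap (τ.comp ((H.map (MulAut.conj (g i)⁻¹).toMonoidHom).subgroupOf K).subtype) (σc i)) :=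
    { toFun := fun Φ i =>
        { toLinearMap :=
            { toFun := fun v => (Φ v).toFun (g i)
              map_add' := fun v w => by rw [map_add, SmoothInd.toFun_add, Pi.add_apply]
              map_smul' := fun c v => by rw [map_smul, SmoothInd.toFun_smul, Pi.smul_apply, RingHom.id_apply] }
          isIntertwining' := fun s => LinearMap.ext fun v => by
            simp only [LinearMap.coe_comp, LinearMap.coe_mk, AddHom.coe_mk, Function.comp_apply, MonoidHom.comp_apply, Subgroup.coe_subtype]
            exact hloc Φ i s v }
      map_add' := fun Φ Φ' => funext fun i => IntertwiningMap.ext (LinearMap.ext fun v => rfl)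
      map_smul' := fun c Φ => funext fun i => IntertwiningMap.ext (LinearMap.ext fun v => rfl) }
  have hev : ∀ (Φ : τ.IntertwiningMap ((smoothIndRep H σ).comp K.subtype)) (i : ι) (v : E), ev Φ i v = (Φ v).toFun (g i) := fun _ _ _ => rfl
  refine ⟨ev, fun Φ Φ' hh => intertwiningMap_ext_of_forall_toFun_apply_eq hcover fun i v => ?_, hev⟩
  rw [← hev Φ i v, ← hev Φ' i v, hh]

variable {H K σ τ} in
/-- **(M4) MACKEY FOR `Hom`: `Hom_K(E, (Ind_H^G σ)|_K) ≃ₗ[k] Πᵢ Hom_{S_{gᵢ}}(E|_{S_{gᵢ}}, σ^{gᵢ})` by `Φ ↦ (e ↦ (Φ e)(gᵢ))ᵢ`** (`K` open, `τ` smooth, `G = ⨆ᵢ H gᵢ K`; the local targets `σcᵢ = σ^{gᵢ}`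
hypothesis-style).  The case `E = 𝟙` is ★ `nonempty_fixedPoints_linearEquiv_pi`. [cite: BernsteinZelevinsky1977, §2.3] [cite: CartierCorvallis1979, §III.3] [cite: Bump1997, Exercise 4.5.5] -/
theorem nonempty_intertwiningMap_linearEquiv_pi {ι : Type*} {g : ι → G} (hKo : IsOpen (K : Set G)) (hτ : τ.IsSmooth)
    (hcover : ∀ y : G, ∃ i, ∃ h : H, ∃ κ ∈ K, y = h * g i * κ)
    (hdisj : ∀ i j, (∃ h : H, ∃ κ ∈ K, g j = h * g i * κ) → i = j)
    (σc : ∀ i, Representation k ↥((H.map (MulAut.conj (g i)⁻¹).toMonoidHom).subgroupOf K) W)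
    (hσc : ∀ (i : ι) (s : ↥((H.map (MulAut.conj (g i)⁻¹).toMonoidHom).subgroupOf K)),
      σc i s = σ ⟨g i * ((s : K) : G) * (g i)⁻¹, (mem_subgroupOf_map_conj_inv_iff H K (g i) s).1 s.2⟩) :
    ∃ e : τ.IntertwiningMap ((smoothIndRep H σ).comp K.subtype) ≃ₗ[k] (Π i, IntertwiningMap (τ.comp ((H.map (MulAut.conj (g i)⁻¹).toMonoidHom).subgroupOf K).subtype) (σc i)),
      ∀ (Φ : τ.IntertwiningMap ((smoothIndRep H σ).comp K.subtype)) (i : ι) (v : E), e Φ i v = (Φ v).toFun (g i) := by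
  obtain ⟨ev, hinj, hev⟩ := exists_linearMap_pi_intertwiningMap_injective (τ := τ) hcover σc hσc
  have hsurj : Function.Surjective ev := fun φ => by
    obtain ⟨Φ, hΦ, -⟩ := exists_intertwiningMap_forall_toFun_eq hKo hτ hcover hdisj σc hσc φ
    refine ⟨Φ, funext fun i => IntertwiningMap.ext (LinearMap.ext fun v => ?_)⟩
    change ev Φ i v = φ i v
    rw [hev, hΦ]
  exact ⟨LinearEquiv.ofBijective ev ⟨hinj, hsurj⟩, fun Φ i v => by rw [LinearEquiv.ofBijective_apply, hev]⟩

/-- **`Hom_K(E, (Ind_H^G σ)|_K)` is finite-dimensional** when the double cosets `H gᵢ K` (`ι` finite) cover `G` and the local Hom-spaces `Hom_{S_{gᵢ}}(E, σ^{gᵢ})` are (`k` a field).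
[cite: BernsteinZelevinsky1977, §2.3] [cite: CartierCorvallis1979, §III.3] -/
theorem finiteDimensional_intertwiningMap_smoothIndRep {k : Type*} [Field k] {W E : Type*} [AddCommGroup W] [Module k W] [AddCommGroup E] [Module k E]
    {H K : Subgroup G} (σ : Representation k H W) (τ : Representation k K E) {ι : Type*} [Finite ι] {g : ι → G}
    (hcover : ∀ y : G, ∃ i, ∃ h : H, ∃ κ ∈ K, y = h * g i * κ)
    (σc : ∀ i, Representation k ↥((H.map (MulAut.conj (g i)⁻¹).toMonoidHom).subgroupOf K) W)
    (hσc : ∀ (i : ι) (s : ↥((H.map (MulAut.conj (g i)⁻¹).toMonoidHom).subgroupOf K)),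
      σc i s = σ ⟨g i * ((s : K) : G) * (g i)⁻¹, (mem_subgroupOf_map_conj_inv_iff H K (g i) s).1 s.2⟩)
    [∀ i, FiniteDimensional k (IntertwiningMap (τ.comp ((H.map (MulAut.conj (g i)⁻¹).toMonoidHom).subgroupOf K).subtype) (σc i))] :
    FiniteDimensional k (τ.IntertwiningMap ((smoothIndRep H σ).comp K.subtype)) := by
  obtain ⟨ev, hinj, -⟩ := exists_linearMap_pi_intertwiningMap_injective (τ := τ) hcover σc hσc
  exact Module.Finite.of_injective ev hinj

/-- **`dim Hom_K(E, (Ind_H^G σ)|_K) ≤ Σᵢ dim Hom_{S_{gᵢ}}(E, σ^{gᵢ})`** from the covering alone (`k` a field, the local Hom-spaces finite-dimensional, `ι` finite).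
[cite: BernsteinZelevinsky1977, §2.3] [cite: CartierCorvallis1979, §III.3] -/
theorem finrank_intertwiningMap_smoothIndRep_le_sum {k : Type*} [Field k] {W E : Type*} [AddCommGroup W] [Module k W] [AddCommGroup E] [Module k E]
    {H K : Subgroup G} (σ : Representation k H W) (τ : Representation k K E) {ι : Type*} [Fintype ι] {g : ι → G}
    (hcover : ∀ y : G, ∃ i, ∃ h : H, ∃ κ ∈ K, y = h * g i * κ)
    (σc : ∀ i, Representation k ↥((H.map (MulAut.conj (g i)⁻¹).toMonoidHom).subgroupOf K) W)
    (hσc : ∀ (i : ι) (s : ↥((H.map (MulAut.conj (g i)⁻¹).toMonoidHom).subgroupOf K)),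
      σc i s = σ ⟨g i * ((s : K) : G) * (g i)⁻¹, (mem_subgroupOf_map_conj_inv_iff H K (g i) s).1 s.2⟩)
    [∀ i, FiniteDimensional k (IntertwiningMap (τ.comp ((H.map (MulAut.conj (g i)⁻¹).toMonoidHom).subgroupOf K).subtype) (σc i))] :
    Module.finrank k (τ.IntertwiningMap ((smoothIndRep H σ).comp K.subtype)) ≤ ∑ i, Module.finrank k (IntertwiningMap (τ.comp ((H.map (MulAut.conj (g i)⁻¹).toMonoidHom).subgroupOf K).subtype) (σc i)) := by
  obtain ⟨ev, hinj, -⟩ := exists_linearMap_pi_intertwiningMap_injective (τ := τ) hcover σc hσc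
  rw [← Module.finrank_pi_fintype k]
  exact LinearMap.finrank_le_finrank_of_injective hinj

/-- **MACKEY'S DIMENSION FORMULA: `dim Hom_K(E, (Ind_H^G σ)|_K) = Σᵢ dim Hom_{S_{gᵢ}}(E, σ^{gᵢ})`** (`k` a field, `K` open, `τ` smooth, `G = ⨆ᵢ H gᵢ K`, `ι` finite; no finiteness of the
Hom-spaces needed — both sides are `0` together when infinite-dimensional). [cite: BernsteinZelevinsky1977, §2.3] [cite: CartierCorvallis1979, §III.3] [cite: Bump1997, Exercise 4.5.5] -/
theorem finrank_intertwiningMap_smoothIndRep_eq_sum {k : Type*} [Field k] {W E : Type*} [AddCommGroup W] [Module k W] [AddCommGroup E] [Module k E]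
    {H K : Subgroup G} (σ : Representation k H W) (τ : Representation k K E) {ι : Type*} [Fintype ι] {g : ι → G}
    (hKo : IsOpen (K : Set G)) (hτ : τ.IsSmooth)
    (hcover : ∀ y : G, ∃ i, ∃ h : H, ∃ κ ∈ K, y = h * g i * κ)
    (hdisj : ∀ i j, (∃ h : H, ∃ κ ∈ K, g j = h * g i * κ) → i = j)
    (σc : ∀ i, Representation k ↥((H.map (MulAut.conj (g i)⁻¹).toMonoidHom).subgroupOf K) W)
    (hσc : ∀ (i : ι) (s : ↥((H.map (MulAut.conj (g i)⁻¹).toMonoidHom).subgroupOf K)),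
      σc i s = σ ⟨g i * ((s : K) : G) * (g i)⁻¹, (mem_subgroupOf_map_conj_inv_iff H K (g i) s).1 s.2⟩)
    [∀ i, FiniteDimensional k (IntertwiningMap (τ.comp ((H.map (MulAut.conj (g i)⁻¹).toMonoidHom).subgroupOf K).subtype) (σc i))] :
    Module.finrank k (τ.IntertwiningMap ((smoothIndRep H σ).comp K.subtype)) = ∑ i, Module.finrank k (IntertwiningMap (τ.comp ((H.map (MulAut.conj (g i)⁻¹).toMonoidHom).subgroupOf K).subtype) (σc i)) := by
  obtain ⟨e, -⟩ := nonempty_intertwiningMap_linearEquiv_pi hKo hτ hcover hdisj σc hσc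
  rw [e.finrank_eq, Module.finrank_pi_fintype]

/-- **THE ONE-COSET CASE `G = H · K`** (e.g. an Iwasawa decomposition `G = B · K`): `dim Hom_K(E, (Ind_H^G σ)|_K) = dim Hom_{S₁}(E, σ)`, `S₁ = {s ∈ K : s ∈ H}` the copy of `H ∩ K` inside
`K` (representative `g = 1`, conjugation trivial). [cite: BernsteinZelevinsky1977, §2.3] [cite: CartierCorvallis1979, §III.3–§IV.1] -/
theorem finrank_intertwiningMap_smoothIndRep_eq_of_mul {k : Type*} [Field k] {W E : Type*} [AddCommGroup W] [Module k W] [AddCommGroup E] [Module k E]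
    {H K : Subgroup G} (σ : Representation k H W) (τ : Representation k K E) (hKo : IsOpen (K : Set G)) (hτ : τ.IsSmooth)
    (hmul : ∀ y : G, ∃ h : H, ∃ κ ∈ K, y = h * κ)
    (σc : Representation k ↥((H.map (MulAut.conj (1 : G)⁻¹).toMonoidHom).subgroupOf K) W)
    (hσc : ∀ s : ↥((H.map (MulAut.conj (1 : G)⁻¹).toMonoidHom).subgroupOf K),
      σc s = σ ⟨1 * ((s : K) : G) * (1 : G)⁻¹, (mem_subgroupOf_map_conj_inv_iff H K 1 s).1 s.2⟩)
    [FiniteDimensional k (IntertwiningMap (τ.comp ((H.map (MulAut.conj (1 : G)⁻¹).toMonoidHom).subgroupOf K).subtype) σc)] :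
    Module.finrank k (τ.IntertwiningMap ((smoothIndRep H σ).comp K.subtype)) =
      Module.finrank k (IntertwiningMap (τ.comp ((H.map (MulAut.conj (1 : G)⁻¹).toMonoidHom).subgroupOf K).subtype) σc) := by
  have h := finrank_intertwiningMap_smoothIndRep_eq_sum σ τ (ι := Unit) (g := fun _ => (1 : G)) hKo hτ
    (fun y => by obtain ⟨h, κ, hκ, hy⟩ := hmul y; exact ⟨(), h, κ, hκ, by rw [mul_one]; exact hy⟩)
    (fun _ _ _ => rfl) (fun _ => σc) (fun _ s => hσc s)
  rw [h, Fintype.sum_unique]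

end Representation

end
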